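import Summits.Ventures.PercRepro.SMC

/-!
# Opening one edge merges at most two blocks of the marked partition

The combinatorial input of the single-merge concavity principle (`proofs/P4-pairsum.md`
Theorem 7, `SMCPrinciple k`): for a marking `m : Fin k → V` and an edge `e = {a, b}`,

* `markedPartition_update_true`: `Π(ω[e:=1]) = Π(ω)`, or `(Π(ω), Π(ω[e:=1]))` is a single
  merge — the blocks of an index `i` with `m i ↔ a` and an index `j` with `m j ↔ b` are merged;
* `markedPartition_update_true_eq_mergeBlocks`: the explicit form when both endpoints of `e`
  touch marked clusters;
* `markedPartition_update_true_eq_of_not_conn`: no change when one endpoint of `e` is joined to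
  no marked vertex.

Everything follows from typer-1's contraction lemma `conn_update_true_iff`.
-/

namespace PercRepro

namespace MultiGraph

variable {V E : Type*} (G : MultiGraph V E) [DecidableEq E] {k : ℕ}

/-- Reading off `Π(ω[e:=1])` through the contraction lemma: `i ~ j` after opening `e = {a, b}`
iff `i ~ j` before, or `m i ↔ a` and `b ↔ m j`, or `m i ↔ b` and `a ↔ m j`. -/
theorem markedPartition_update_true_rel (ω : Config E) (e : E) (m : Fin k → V) (i j : Fin k) :
    G.markedPartition (Function.update ω e true) m i j ↔
      G.markedPartition ω m i j ∨
        (G.Conn ω (m i) (G.fst e) ∧ G.Conn ω (G.snd e) (m j)) ∨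
          (G.Conn ω (m i) (G.snd e) ∧ G.Conn ω (G.fst e) (m j)) := by
  rw [markedPartition_rel, markedPartition_rel, conn_update_true_iff]

/-- If no marked vertex is joined to `a`, opening `e = {a, b}` does not change the marked
partition (and symmetrically for `b`). -/
theorem markedPartition_update_true_eq_of_not_conn (ω : Config E) (e : E) (m : Fin k → V)
    (h : (∀ i, ¬ G.Conn ω (m i) (G.fst e)) ∨ ∀ j, ¬ G.Conn ω (m j) (G.snd e)) :
    G.markedPartition (Function.update ω e true) m = G.markedPartition ω m := by
  refine le_antisymm (Setoid.le_def.2 fun {i j} hij => ?_)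
    (G.markedPartition_mono m (le_update_true ω e))
  rcases (G.markedPartition_update_true_rel ω e m i j).1 hij with h0 | ⟨h1, h2⟩ | ⟨h1, h2⟩
  · exact h0
  · rcases h with h | h
    · exact absurd h1 (h i)
    · exact absurd h2.symm (h j)
  · rcases h with h | h
    · exact absurd h2.symm (h j)
    · exact absurd h1 (h i)

/-- If `m i ↔ a` and `m j ↔ b`, opening `e = {a, b}` merges exactly the blocks of `i` and `j`:
`Π(ω[e:=1]) = mergeBlocks Π(ω) i j`. -/
theorem markedPartition_update_true_eq_mergeBlocks (ω : Config E) (e : E) (m : Fin k → V)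
    {i j : Fin k} (hi : G.Conn ω (m i) (G.fst e)) (hj : G.Conn ω (m j) (G.snd e)) :
    G.markedPartition (Function.update ω e true) m = mergeBlocks (G.markedPartition ω m) i j := by
  apply Setoid.ext
  intro x y
  rw [markedPartition_update_true_rel, mergeBlocks_rel, markedPartition_rel, markedPartition_rel,
    markedPartition_rel, markedPartition_rel, markedPartition_rel]
  constructor
  · rintro (h0 | ⟨h1, h2⟩ | ⟨h1, h2⟩)
    · exact Or.inl h0
    · exact Or.inr (Or.inl ⟨h1.trans hi.symm, hj.trans h2⟩)
    · exact Or.inr (Or.inr ⟨h1.trans hj.symm, hi.trans h2⟩)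
  · rintro (h0 | ⟨h1, h2⟩ | ⟨h1, h2⟩)
    · exact Or.inl h0
    · exact Or.inr (Or.inl ⟨h1.trans hi, hj.symm.trans h2⟩)
    · exact Or.inr (Or.inr ⟨h1.trans hj, hi.symm.trans h2⟩)

/-- **Single-merge transition lemma** (general `k`): opening one edge leaves the marked partition
unchanged or merges exactly two of its blocks, i.e. `Π(ω[e:=1]) = Π(ω)` or
`IsSingleMerge Π(ω) Π(ω[e:=1])`. -/
theorem markedPartition_update_true (ω : Config E) (e : E) (m : Fin k → V) :
    G.markedPartition (Function.update ω e true) m = G.markedPartition ω m ∨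
      IsSingleMerge (G.markedPartition ω m) (G.markedPartition (Function.update ω e true) m) := by
  by_cases hi : ∃ i, G.Conn ω (m i) (G.fst e)
  · by_cases hj : ∃ j, G.Conn ω (m j) (G.snd e)
    · obtain ⟨i, hi⟩ := hi
      obtain ⟨j, hj⟩ := hj
      have hmerge := G.markedPartition_update_true_eq_mergeBlocks ω e m hi hj
      by_cases hij : G.markedPartition ω m i j
      · exact Or.inl (by rw [hmerge, mergeBlocks_of_rel hij])
      · exact Or.inr ⟨i, j, hij, hmerge⟩
    · exact Or.inl (G.markedPartition_update_true_eq_of_not_conn ω e m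
        (Or.inr fun j hj' => hj ⟨j, hj'⟩))
  · exact Or.inl (G.markedPartition_update_true_eq_of_not_conn ω e m
      (Or.inl fun i hi' => hi ⟨i, hi'⟩))

/-- The marked partition after opening an edge, as a disjunction over the two cases of
`markedPartition_update_true`, in the form used by edge-induction proofs: for every `τ`,
`Π(ω[e:=1]) = τ` implies `τ = Π(ω)` or `IsSingleMerge Π(ω) τ`. -/
theorem eq_or_isSingleMerge_of_markedPartition_update_true (ω : Config E) (e : E)
    (m : Fin k → V) {τ : Setoid (Fin k)}
    (h : G.markedPartition (Function.update ω e true) m = τ) :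
    τ = G.markedPartition ω m ∨ IsSingleMerge (G.markedPartition ω m) τ := by
  rw [← h]
  exact G.markedPartition_update_true ω e m

/-- Closing an edge does not change the marked partition in the configuration where that edge was
already closed: `Π(ω[e:=0]) = Π(ω)` when `ω e = false`. -/
theorem markedPartition_update_false_of_eq_false (ω : Config E) {e : E} (he : ω e = false)
    (m : Fin k → V) : G.markedPartition (Function.update ω e false) m = G.markedPartition ω m := by
  rw [← he, Function.update_eq_self]

/-- The marked partition is monotone along opening an edge: `Π(ω) ≤ Π(ω[e:=1])`. -/
theorem markedPartition_le_update_true (ω : Config E) (e : E) (m : Fin k → V) :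
    G.markedPartition ω m ≤ G.markedPartition (Function.update ω e true) m :=
  G.markedPartition_mono m (le_update_true ω e)

end MultiGraph

end PercRepro
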